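import Summits.CriticalPhenomena.Ising3DConformalLimit.Theorems.PerfectScreeningScreeningDichotomy
import Summits.CriticalPhenomena.Ising3DConformalLimit.Theorems.PerfectScreeningGreenAsymptotics
import Literature.Probability.LatticeModels.CorrelationDecayProofs
import HarnessLib

/-!
# Route `PerfectScreening`, support item `EventuallySubharmonic` (stmt-CriticalPhenomena-13887)

THEOREM-ONLY file (no definitions, no named facts), `--supports stmt-CriticalPhenomena-13887`.

The item says that the critical two-point function `G := ⟨σ₀σ_x⟩⁺_{β_c(3)} = criticalTwoPoint 3`
of the nearest-neighbour Ising model on `ℤ³` is lattice-subharmonic OUTSIDE A FINITE BALL: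
`∃ R, ∀ x, R < ‖x‖ → 6·G(x) ≤ ∑ᵢ (G(x+eᵢ) + G(x−eᵢ))`, i.e. `Δ_{ℤ³} G ≥ 0` cofinitely — the
pre-filed repair (finite exceptional set) of the crux `SubharmonicOffOrigin` ("SubH", item 1341).
Mathematically it is the ANALYTIC TAIL of SubH: for `G ≍ A‖x‖^{-1-η}` the continuum Laplacian is
`A η(1+η) ‖x‖^{-3-η}`, so the sign of `Δ G` far out is "`η(3) > 0` with second-difference control
of the corrections to scaling" — an OPEN PROBLEM in print (even the existence of `η(3)`, or the
weaker non-saturation `liminf n·G(n e₁) = 0`, is open: Duminil-Copin, ICM 2022 §4.2.1/§8.4;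
Duminil-Copin–Panis 2025 give lower bounds only). Nothing in the tree decides it, and — `G` being
a genuine (non-computable, junk-free) infinite-volume limit — no kernel-level refutation exists
either (cf. the disprover's workfile `Cruxes/SubharmonicOffOrigin/Disproof.lean`).

What IS provable about the item today is recorded here, sorry-free:

* `exists_forall_lt_norm_iff_eventually_cofinite`, `exists_forall_lt_norm_iff_exists_supNorm`
  (general `ℤ^d` bookkeeping) and the reformulations
  `eventuallySubharmonic_iff_exists_laplacian_nonneg / _iff_eventually_cofinite /
  _iff_exists_supNorm / _iff_finite_exceptional`: the item ⇔ `Δ G ≥ 0` cofinitely ⇔ outside a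
  sup-norm box ⇔ the exceptional set `{Δ G < 0}` is finite;
* `eventuallySubharmonic_of_subharmonicOffOrigin`: SubH (1341) ⇒ the item (`R = 0`), and the
  core/tail reassembly `subharmonicOffOrigin_of_core_of_tail`,
  `subharmonicOffOrigin_iff_core_and_tail` (the shape used by the crux idea
  `certified-core-eventual-tail`: a finite certified core `0 < ‖x‖ ≤ R` plus this item AT the
  same `R` give SubH back);
* `screeningUpgrade_of_eventuallySubharmonic`: the exterior maximum principle of
  `screeningUpgrade_proof` (item 1346) needs subharmonicity only outside a box, so
  `GreenAsymptotics → EventuallySubharmonic → NonSaturation → ‖x‖·G(x) → 0`;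
* `coulomb_or_screened_of_eventuallySubharmonic`: hence the SCREENING DICHOTOMY (Coulomb lower
  bound `c/‖x‖ ≤ G` or perfect screening `‖x‖G → 0`) already follows from the item — this is the
  content of the sibling support item `ScreeningDichotomyEventual` (13888);
* `conjunct_of_eventuallySubharmonic`: the route's deciding theorem RE-CERTIFIED with this item in
  place of the pair (SubharmonicOffOrigin, ScreeningDichotomy): `EventuallySubharmonic ∧
  CoulombImpliesNontrivial ∧ GaussianLimitNotScreened ∧ MoebiusLimitExists ⇒
  Ising3DConformalLimit` (`GreenAsymptotics` being the tree theorem `GreenAsymptotics_proof`).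

References: A. Messager, S. Miracle-Solé, J. Stat. Phys. 17 (1977) 245–262; G. F. Lawler,
V. Limic, *Random Walk: A Modern Introduction* (2010) §6.1–6.2 (maximum principle), Thm 4.3.1;
H. Duminil-Copin, ICM 2022, §4.2.1, §8.4; H. Duminil-Copin, R. Panis, arXiv:2404.05700, Thm 1.5.
-/

noncomputable section

namespace Summit.CriticalPhenomena.Ising3DConformalLimit.Theorems

open Filter Topology Finset
open Literature.Probability.LatticeModels
open Summit.CriticalPhenomena.Ising3DConformalLimit.Theses.PerfectScreening

/-! ### `∃ R, ∀ ‖x‖ > R` on `ℤ^d`: filter and sup-norm forms -/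

/-- On `ℤ^d`, "`P x` for all `x` outside some ball" is "`P x` for cofinitely many `x`"
(balls of `ℤ^d` are finite: `‖x‖ → ∞` along `cofinite`). [folklore] -/
theorem exists_forall_lt_norm_iff_eventually_cofinite {d : ℕ} (P : Site d → Prop) :
    (∃ R : ℝ, ∀ x : Site d, R < ‖x‖ → P x) ↔ ∀ᶠ x in cofinite, P x := by
  constructor
  · rintro ⟨R, hR⟩
    exact ((Site.tendsto_norm_cofinite_atTop (d := d)).eventually (eventually_gt_atTop R)).mono hR
  · intro h
    rw [eventually_cofinite] at h
    obtain ⟨R, hR⟩ := (h.image fun x : Site d => ‖x‖).bddAbove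
    refine ⟨R, fun x hx => ?_⟩
    by_contra hP
    exact (not_le.2 hx) (hR ⟨x, hP, rfl⟩)

/-- On `ℤ^d`, "`P x` for all `x` outside some ball" may be taken with a natural sup-norm
threshold: `∃ n : ℕ, ∀ x, n < ‖x‖_∞ → P x` (`‖x‖ = ‖x‖_∞`, `Site.norm_eq_supNorm`). [folklore] -/
theorem exists_forall_lt_norm_iff_exists_supNorm {d : ℕ} (P : Site d → Prop) :
    (∃ R : ℝ, ∀ x : Site d, R < ‖x‖ → P x) ↔ ∃ n : ℕ, ∀ x : Site d, n < Site.supNorm x → P x := by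
  constructor
  · rintro ⟨R, hR⟩
    refine ⟨⌈max R 0⌉₊, fun x hx => hR x ?_⟩
    rw [Site.norm_eq_supNorm]
    calc R ≤ max R 0 := le_max_left _ _
      _ ≤ ⌈max R 0⌉₊ := Nat.le_ceil _
      _ < Site.supNorm x := by exact_mod_cast hx
  · rintro ⟨n, hn⟩
    refine ⟨n, fun x hx => hn x ?_⟩
    rw [Site.norm_eq_supNorm] at hx
    exact_mod_cast hx

/-! ### The item in Laplacian / filter language -/

/-- `EventuallySubharmonic` ⇔ the `ℤ³` Laplacian of the critical two-point function is
nonnegative outside some ball. [folklore] -/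
theorem eventuallySubharmonic_iff_exists_laplacian_nonneg :
    EventuallySubharmonic ↔
      ∃ R : ℝ, ∀ x : Site 3, R < ‖x‖ → 0 ≤ latticeLaplacianZd (criticalTwoPoint 3) x := by
  unfold EventuallySubharmonic
  refine exists_congr fun R => forall_congr' fun x => imp_congr_right fun _ => ?_
  rw [latticeLaplacianZd_nonneg_iff]
  norm_num

/-- `EventuallySubharmonic` ⇔ `Δ G ≥ 0` for cofinitely many sites. [folklore] -/
theorem eventuallySubharmonic_iff_eventually_cofinite :
    EventuallySubharmonic ↔
      ∀ᶠ x : Site 3 in cofinite, 0 ≤ latticeLaplacianZd (criticalTwoPoint 3) x := by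
  rw [eventuallySubharmonic_iff_exists_laplacian_nonneg]
  exact exists_forall_lt_norm_iff_eventually_cofinite _

/-- `EventuallySubharmonic` ⇔ `Δ G ≥ 0` outside a sup-norm box `Λ_n` — the form consumed by the
exterior maximum principle `le_on_exterior_of_le_on_sphere`. [folklore] -/
theorem eventuallySubharmonic_iff_exists_supNorm :
    EventuallySubharmonic ↔
      ∃ n : ℕ, ∀ x : Site 3, n < Site.supNorm x → 0 ≤ latticeLaplacianZd (criticalTwoPoint 3) x := by
  rw [eventuallySubharmonic_iff_exists_laplacian_nonneg]
  exact exists_forall_lt_norm_iff_exists_supNorm _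

/-- `EventuallySubharmonic` ⇔ the exceptional set `{x | Δ G (x) < 0}` ("positive screening
charges off the origin") is finite. [folklore] -/
theorem eventuallySubharmonic_iff_finite_exceptional :
    EventuallySubharmonic ↔
      {x : Site 3 | latticeLaplacianZd (criticalTwoPoint 3) x < 0}.Finite := by
  rw [eventuallySubharmonic_iff_eventually_cofinite, eventually_cofinite]
  simp only [not_le]

/-! ### From and to the crux `SubharmonicOffOrigin` -/

/-- **SubH ⇒ the item** (`R = 0`: `0 < ‖x‖ ↔ x ≠ 0`). The ledger link 13887 ⇐ 1341.
[folklore] -/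
theorem eventuallySubharmonic_of_subharmonicOffOrigin (h : SubharmonicOffOrigin) :
    EventuallySubharmonic :=
  ⟨0, fun x hx => h x (norm_pos_iff.1 hx)⟩

/-- **Core + tail ⇒ SubH**: subharmonicity on the punctured ball `0 < ‖x‖ ≤ R` together with
the item AT THE SAME radius `R` reassembles the crux `SubharmonicOffOrigin`. [folklore] -/
theorem subharmonicOffOrigin_of_core_of_tail {R : ℝ}
    (hcore : ∀ x : Site 3, x ≠ 0 → ‖x‖ ≤ R → 6 * criticalTwoPoint 3 x ≤
      ∑ i : Fin 3, (criticalTwoPoint 3 (x + Pi.single i 1) + criticalTwoPoint 3 (x - Pi.single i 1)))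
    (htail : ∀ x : Site 3, R < ‖x‖ → 6 * criticalTwoPoint 3 x ≤
      ∑ i : Fin 3, (criticalTwoPoint 3 (x + Pi.single i 1) + criticalTwoPoint 3 (x - Pi.single i 1))) :
    SubharmonicOffOrigin := by
  unfold SubharmonicOffOrigin
  intro x hx
  rcases le_or_gt ‖x‖ R with h | h
  · exact hcore x hx h
  · exact htail x h

/-- **SubH ⇔ core ∧ tail** at any radius `R ≥ 0`. [folklore] -/
theorem subharmonicOffOrigin_iff_core_and_tail {R : ℝ} (hR : 0 ≤ R) :
    SubharmonicOffOrigin ↔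
      (∀ x : Site 3, x ≠ 0 → ‖x‖ ≤ R → 6 * criticalTwoPoint 3 x ≤
        ∑ i : Fin 3, (criticalTwoPoint 3 (x + Pi.single i 1) + criticalTwoPoint 3 (x - Pi.single i 1))) ∧
      (∀ x : Site 3, R < ‖x‖ → 6 * criticalTwoPoint 3 x ≤
        ∑ i : Fin 3, (criticalTwoPoint 3 (x + Pi.single i 1) + criticalTwoPoint 3 (x - Pi.single i 1))) := by
  constructor
  · intro h
    exact ⟨fun x hx _ => h x hx, fun x hx => h x (norm_pos_iff.1 (hR.trans_lt hx))⟩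
  · rintro ⟨hcore, htail⟩
    exact subharmonicOffOrigin_of_core_of_tail hcore htail

/-- In particular SubH ⇔ (core at `R`) ∧ `EventuallySubharmonic`-witnessed-at-`R`; so the item
is SubH minus finitely many (non-universal, short-distance) inequalities. [folklore] -/
theorem subharmonicOffOrigin_iff_exists_core_and_tail :
    SubharmonicOffOrigin ↔ ∃ R : ℝ,
      (∀ x : Site 3, x ≠ 0 → ‖x‖ ≤ R → 6 * criticalTwoPoint 3 x ≤
        ∑ i : Fin 3, (criticalTwoPoint 3 (x + Pi.single i 1) + criticalTwoPoint 3 (x - Pi.single i 1))) ∧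
      (∀ x : Site 3, R < ‖x‖ → 6 * criticalTwoPoint 3 x ≤
        ∑ i : Fin 3, (criticalTwoPoint 3 (x + Pi.single i 1) + criticalTwoPoint 3 (x - Pi.single i 1))) := by
  constructor
  · intro h
    exact ⟨0, (subharmonicOffOrigin_iff_core_and_tail le_rfl).1 h⟩
  · rintro ⟨R, hcore, htail⟩
    exact subharmonicOffOrigin_of_core_of_tail hcore htail

/-! ### The screening upgrade and the dichotomy need only EVENTUAL subharmonicity -/

/-- **Perfect screening from non-saturation, eventual form.** If `G₀` has Coulomb asymptotics
(`GreenAsymptotics`), `G` is lattice-subharmonic outside some ball (`EventuallySubharmonic`) and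
`liminf_n n·G(n e₁) = 0` (`NonSaturation`), then `‖x‖·G(x) → 0` cofinitely. The proof of
`screeningUpgrade_proof` verbatim, except that the non-saturated scale `n` is also taken beyond
the exceptional ball: the exterior maximum principle compares `G` with `λ G₀` only on
`{‖x‖_∞ ≥ n}`. [folklore] -/
theorem screeningUpgrade_of_eventuallySubharmonic (hGA : GreenAsymptotics)
    (hEv : EventuallySubharmonic) (hNonSat : NonSaturation) :
    Tendsto (fun x : Site 3 => ‖x‖ * criticalTwoPoint 3 x) cofinite (𝓝 0) := by
  -- adapted from `screeningUpgrade_proof` (PerfectScreeningScreeningUpgrade.lean)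
  obtain ⟨a, K, ha, hGA⟩ := hGA
  obtain ⟨m, hΔG⟩ := eventuallySubharmonic_iff_exists_supNorm.1 hEv
  set G : Site 3 → ℝ := criticalTwoPoint 3 with hG
  set G₀ : Site 3 → ℝ := fun x => latticeGreen x / 2 with hG₀
  have h3 : (3 : ℕ) ≤ 3 := le_rfl
  have hGA' : ∀ x : Site 3, x ≠ 0 →
      |G₀ x - a / Real.sqrt (∑ i, ((x i : ℤ) : ℝ) ^ 2)| ≤ K / (∑ i, ((x i : ℤ) : ℝ) ^ 2) := by
    intro x hx
    have h := hGA x hx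
    rwa [setIntegral_pi_cos_div_eq_half_latticeGreen x] at h
  have hGnn : ∀ x, 0 ≤ G x := fun x => twoPointPlus_nonneg_of_gks (criticalBeta_nonneg 3) x
  have hGlim : Tendsto G cofinite (𝓝 0) := criticalTwoPoint_tendsto_zero_cofinite
  have hG₀lim : Tendsto G₀ cofinite (𝓝 0) := by
    simpa using (tendsto_latticeGreen_cofinite 3 h3).div_const 2
  have hΔG₀ : ∀ x : Site 3, latticeLaplacianZd G₀ x ≤ 0 := by
    intro x
    rw [hG₀, latticeLaplacianZd_half_latticeGreen 3 h3 x]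
    split_ifs <;> norm_num
  rw [Metric.tendsto_nhds]
  intro ε hε
  set ε' : ℝ := ε / 16 with hε'
  have hε'0 : 0 < ε' := by positivity
  set R₀ : ℝ := 2 * max K 0 / a with hR₀
  -- a large non-saturated axial scale `n`, beyond `R₀` AND beyond the exceptional box `Λ_m`
  obtain ⟨n, hn, hnG⟩ := Filter.frequently_atTop.1 (hNonSat ε' hε'0) (max (max 1 ⌈R₀⌉₊) m)
  have hn1 : 1 ≤ n := le_of_max_le_left (le_of_max_le_left hn)
  have hnm : m ≤ n := le_of_max_le_right hn
  have hnR : R₀ ≤ (n : ℝ) :=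
    (Nat.le_ceil R₀).trans (by exact_mod_cast le_of_max_le_right (le_of_max_le_left hn))
  have hn0 : (0 : ℝ) < n := by exact_mod_cast hn1
  set lam : ℝ := 4 * ε' / a with hlam
  have hlam0 : 0 < lam := by positivity
  have hcomp : ∀ x : Site 3, n ≤ Site.supNorm x → G x ≤ lam * G₀ x := by
    refine le_on_exterior_of_le_on_sphere (d := 3) (by norm_num) (v := fun x => lam * G₀ x)
      (fun x hx => hΔG x (by omega)) (fun x _ => ?_) (fun y hy => ?_) hGlim ?_
    · rw [latticeLaplacianZd_const_mul]
      exact mul_nonpos_of_nonneg_of_nonpos hlam0.le (hΔG₀ x)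
    · have hy0 : y ≠ 0 := by
        intro hy0
        rw [hy0, Site.supNorm_eq_zero_iff.2 rfl] at hy
        omega
      have hyR : R₀ ≤ (Site.supNorm y : ℝ) := by rw [hy]; exact hnR
      have hlow := (green_window_of_asymptotics ha hGA' hy0 hyR).1
      rw [hy] at hlow
      have h1 : G y < ε' / n := by
        calc G y ≤ G (Pi.single 0 (n : ℤ)) := criticalTwoPoint_three_le_axis hy
          _ < ε' / n := by
            rw [lt_div_iff₀ hn0, mul_comm]
            exact hnG
      have h2 : ε' / n ≤ lam * G₀ y := by
        calc ε' / n = lam * (a / (4 * n)) := by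
              rw [hlam]
              field_simp
          _ ≤ lam * G₀ y := mul_le_mul_of_nonneg_left hlow hlam0.le
      exact (h1.trans_le h2).le
    · simpa using hG₀lim.const_mul lam
  rw [eventually_cofinite]
  refine (box 3 n).finite_toSet.subset fun x hx => ?_
  rw [Finset.mem_coe, mem_box_iff_supNorm_le]
  by_contra hxn
  apply hx
  have hnx : n ≤ Site.supNorm x := by omega
  have hx0 : x ≠ 0 := by
    intro hx0
    rw [hx0, Site.supNorm_eq_zero_iff.2 rfl] at hnx
    omega
  set N : ℝ := (Site.supNorm x : ℝ) with hN
  have hN0 : 0 < N := by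
    rw [hN]; exact_mod_cast one_le_supNorm_of_ne_zero hx0
  have hxR : R₀ ≤ N := hnR.trans (by rw [hN]; exact_mod_cast hnx)
  have hup := (green_window_of_asymptotics ha hGA' hx0 hxR).2
  have hGx : G x ≤ 8 * ε' / N := by
    calc G x ≤ lam * G₀ x := hcomp x hnx
      _ ≤ lam * (2 * a / N) := mul_le_mul_of_nonneg_left hup hlam0.le
      _ = 8 * ε' / N := by rw [hlam]; field_simp; ring
  rw [Real.dist_eq, sub_zero, Site.norm_eq_supNorm, ← hN,
    abs_of_nonneg (mul_nonneg hN0.le (hGnn x))]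
  calc N * G x ≤ N * (8 * ε' / N) := mul_le_mul_of_nonneg_left hGx hN0.le
    _ = 8 * ε' := by field_simp
    _ < ε := by rw [hε']; linarith

/-- **Coulomb or screened, from the item.** `GreenAsymptotics → EventuallySubharmonic →`
(`∃ c > 0, ∀ x ≠ 0, c/‖x‖ ≤ G x`) ∨ (`‖x‖·G(x) → 0` cofinitely): case split on `NonSaturation`;
the screened branch is `screeningUpgrade_of_eventuallySubharmonic`, the Coulomb branch is
Messager–Miracle-Solé (`coulomb_of_eventually_axis`) and does not use the item. This is the
content of the sibling support item `ScreeningDichotomyEventual` (stmt-CriticalPhenomena-13888).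
[folklore] -/
theorem coulomb_or_screened_of_eventuallySubharmonic (hGA : GreenAsymptotics)
    (hEv : EventuallySubharmonic) :
    (∃ c : ℝ, 0 < c ∧ ∀ x : Site 3, x ≠ 0 → c / ‖x‖ ≤ criticalTwoPoint 3 x) ∨
      Tendsto (fun x : Site 3 => ‖x‖ * criticalTwoPoint 3 x) cofinite (𝓝 0) := by
  by_cases hNS : ∀ ε : ℝ, 0 < ε →
      ∃ᶠ n : ℕ in Filter.atTop, (n : ℝ) * criticalTwoPoint 3 (Pi.single 0 (n : ℤ)) < ε
  · exact Or.inr (screeningUpgrade_of_eventuallySubharmonic hGA hEv hNS)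
  · left
    push Not at hNS
    obtain ⟨ε, hε, hev⟩ := hNS
    obtain ⟨N₀, hN₀⟩ := Filter.eventually_atTop.1 hev
    exact PerfectScreening.coulomb_of_eventually_axis hε hN₀

/-- **The deciding theorem re-certified with the item in place of SubH.** From
`EventuallySubharmonic` (13887), `CoulombImpliesNontrivial` (r3), `GaussianLimitNotScreened`
(r4) and `MoebiusLimitExists` (r5) the sub-problem `Ising3DConformalLimit` follows — the glue of
`Theses.PerfectScreening.closes` with `coulomb_or_screened_of_eventuallySubharmonic` for the
dichotomy and the tree theorem `GreenAsymptotics_proof` for the Green asymptotics. [folklore] -/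
theorem conjunct_of_eventuallySubharmonic (hEv : EventuallySubharmonic)
    (hCU4 : CoulombImpliesNontrivial) (hGNS : GaussianLimitNotScreened)
    (hML : MoebiusLimitExists) : _root_.Ising3DConformalLimit := by
  obtain ⟨ρ, Δ, S, hρ, hΔ, hlim, hnd, hM⟩ := hML
  refine ⟨ρ, Δ, S, hρ, hΔ, hlim, hnd, hM, ?_⟩
  by_contra hU4
  rcases coulomb_or_screened_of_eventuallySubharmonic GreenAsymptotics_proof hEv with hC | hS
  · exact hU4 (hCU4 hC ρ S hρ hlim hnd)
  · exact hGNS ρ Δ S hρ hlim hnd hM hU4 hS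

end Summit.CriticalPhenomena.Ising3DConformalLimit.Theorems
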